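import Mathlib.Analysis.Calculus.Monotone
import Mathlib.MeasureTheory.Function.JacobianOneDim
import Mathlib.MeasureTheory.Integral.IntervalIntegral.FundThmCalculus
import Mathlib.Analysis.SpecialFunctions.Integrals.Basic
import HarnessLib

/-!
# Monotone functions: the integral of the derivative, and growth from a differential inequality

Real-variable input of the lower density bound in B. White's proof of the closure theorem
[White1989, p. 211; Bandara 2006, Thm. 3.2.8]: there, `f(r) = ‖T‖ 𝐁(x, r)` is non-decreasing, the
slicing and isoperimetric inequalities give a differential inequality
`(d/dr) f(r)^{1/n} ≥ 1/(2nc)` for almost every small `r`, and one concludes `f(r)^{1/n} ≥ r/(2nc)`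
by integration. Since a monotone function need not be absolutely continuous, the honest form of
this integration is the ONE-SIDED inequality `∫_a^b f' ≤ f(b) − f(a)` (Lebesgue), which is all
that is needed for lower bounds. This file proves it from Mathlib's one-dimensional change of
variables for monotone maps, and packages the comparison ("barrier") argument:

* `Monotone.lintegral_deriv_le` — for a monotone `f : ℝ → ℝ` and real `a`, `b`,
  `∫⁻_{(a,b)} (f')⁺ ≤ f(b) − f(a)` (the derivative exists a.e. by Lebesgue's theorem,
  `Monotone.ae_differentiableAt`; on the set of differentiability points the integral of `f'` is
  the measure of the image, `lintegral_deriv_eq_volume_image_of_monotoneOn`, and the image of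
  `(a, b)` lies in `[f a, f b]`);
* **`Monotone.barrier_le`** — **growth from a differential inequality below a barrier**: let `H` be
  monotone, `b` a continuous non-decreasing barrier on `[0, S]` with a continuous derivative `b'`
  on `(0, S)`, `b(0) ≤ H` on `(0, S)`, and suppose that at almost every `s ∈ (0, S)` with
  `H(s) < b(s)` the function `H` is differentiable with `H'(s) ≥ 2 b'(s)`. Then `b ≤ H` on
  `(0, S)`. (If `H(s₁) < b(s₁)`, let `s₀` be the last time before `s₁` at which `H ≥ b`; on
  `(s₀, s₁]` the hypothesis gives `H' ≥ 2b'`, whence `H(s₁) − H(t) ≥ 2(b(s₁) − b(t))` for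
  `t ∈ (s₀, s₁)`, while `H(t) ≥ b(s₀)`; letting `t ↓ s₀` contradicts `H(s₁) < b(s₁)`.)

Theorems only; no definitions, no named facts.

## References

* B. White, *A new proof of the compactness theorem for integral currents*, Comment. Math. Helv.
  64 (1989) 207–220, p. 211 [White1989]; M. L. Bandara, *White's Compactness Theorem for Integral
  Currents* (Monash honours thesis, 2006), Lemma 3.2.6, Thm. 3.2.8 (held:
  `lit paper:galaxy-pdf-8023002039701172160`, pp. 27–29).
* H. Federer, *Geometric Measure Theory*, Springer 1969, 2.9.19 (differentiation of monotone
  functions) [Federer1969].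
-/

noncomputable section

open scoped ENNReal NNReal Topology
open MeasureTheory Set Filter Function

namespace Literature.Geometry.GeometricMeasureTheory

/-! ### The integral of the derivative of a monotone function -/

section IntegralDeriv

/-- **`∫_a^b f' ≤ f(b) − f(a)` for a monotone function** (Lebesgue; one-sided form of the
fundamental theorem of calculus for monotone, not necessarily absolutely continuous, `f`): with
`f'` the a.e. derivative (`deriv f`, which exists a.e. by Lebesgue's differentiation theorem),
`∫⁻_{(a,b)} (f')⁺ dℒ¹ ≤ f(b) − f(a)`. On the (measurable, conull) set of differentiability points
the integral of `f'` is the Lebesgue measure of the image (change of variables for monotone maps),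
and `f((a,b)) ⊆ [f a, f b]`. [cite: Federer1969, 2.9.19; White1989, p. 211] -/
theorem Monotone.lintegral_deriv_le {f : ℝ → ℝ} (hf : Monotone f) (a b : ℝ) :
    ∫⁻ x in Ioo a b, ENNReal.ofReal (deriv f x) ≤ ENNReal.ofReal (f b - f a) := by
  set D : Set ℝ := {x | DifferentiableAt ℝ f x} with hD
  have hDm : MeasurableSet D := measurableSet_of_differentiableAt ℝ f
  set S : Set ℝ := Ioo a b ∩ D with hS
  have hSm : MeasurableSet S := measurableSet_Ioo.inter hDm
  -- the integral over `(a,b)` is the integral over `S`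
  have hae : ∀ᵐ x ∂(volume : Measure ℝ), x ∈ D := hf.ae_differentiableAt
  have hDuniv : (D : Set ℝ) =ᵐ[volume] (univ : Set ℝ) := ae_eq_univ.2 (ae_iff.1 hae)
  have hset : (S : Set ℝ) =ᵐ[volume] (Ioo a b : Set ℝ) := inter_ae_eq_left_of_ae_eq_univ hDuniv
  have h1 : ∫⁻ x in Ioo a b, ENNReal.ofReal (deriv f x) = ∫⁻ x in S, ENNReal.ofReal (deriv f x) :=
    (setLIntegral_congr hset).symm
  rw [h1]
  -- change of variables on `S`
  have hderiv : ∀ x ∈ S, HasDerivWithinAt f (deriv f x) S x := fun x hx =>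
    hx.2.hasDerivAt.hasDerivWithinAt
  rw [lintegral_deriv_eq_volume_image_of_monotoneOn hSm hderiv (hf.monotoneOn S)]
  -- the image lies in `[f a, f b]`
  calc volume (f '' S) ≤ volume (Icc (f a) (f b)) := by
        refine measure_mono ?_
        rintro _ ⟨x, hx, rfl⟩
        exact ⟨hf hx.1.1.le, hf hx.1.2.le⟩
    _ = ENNReal.ofReal (f b - f a) := Real.volume_Icc

end IntegralDeriv

/-! ### Growth below a barrier -/

section Barrier

/-- **Growth from a differential inequality below a barrier.** Let `H : ℝ → ℝ` be monotone, and let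
`b` be continuous and non-decreasing on `[0, S]`, with a derivative `b'` on `(0, S)` which
is continuous and non-negative there. Suppose `b(0) ≤ H(s)` for all `s ∈ (0, S)`, and that for
almost every `s ∈ (0, S)` with `H(s) < b(s)`, `H` is differentiable at `s` with
`2 b'(s) ≤ H'(s)`. Then `b(s) ≤ H(s)` for every `s ∈ (0, S)`. This is the integration step of
White's lower density lemma ("`r/(2nc) ≤ f(r)^{1/n}`", Bandara Thm. 3.2.8), valid for monotone
`H` that need not be absolutely continuous. [cite: White1989, p. 211] -/
theorem Monotone.barrier_le {H b b' : ℝ → ℝ} (hH : Monotone H) {S : ℝ}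
    (hb : ContinuousOn b (Icc 0 S)) (hbm : MonotoneOn b (Icc 0 S))
    (hb' : ∀ s ∈ Ioo 0 S, HasDerivAt b (b' s) s) (hb'c : ContinuousOn b' (Ioo 0 S))
    (hb'0 : ∀ s ∈ Ioo 0 S, 0 ≤ b' s) (h0 : ∀ s ∈ Ioo 0 S, b 0 ≤ H s)
    (hae : ∀ᵐ s ∂(volume : Measure ℝ), s ∈ Ioo 0 S → H s < b s →
      DifferentiableAt ℝ H s ∧ 2 * b' s ≤ deriv H s) :
    ∀ s ∈ Ioo 0 S, b s ≤ H s := by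
  intro s₁ hs₁
  by_contra hlt
  rw [not_le] at hlt
  -- the last good time before `s₁` (or `0`)
  set A : Set ℝ := insert 0 {s | s ∈ Ioc 0 s₁ ∧ b s ≤ H s} with hA
  have hAne : A.Nonempty := ⟨0, mem_insert _ _⟩
  have hAbdd : BddAbove A := ⟨s₁, fun s hs => by
    rcases hs with rfl | hs
    · exact hs₁.1.le
    · exact hs.1.2⟩
  have hAle : ∀ s ∈ A, s ≤ s₁ := fun s hs => by
    rcases hs with rfl | hs
    · exact hs₁.1.le
    · exact hs.1.2
  have hA0 : ∀ s ∈ A, 0 ≤ s := fun s hs => by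
    rcases hs with rfl | hs
    · exact le_rfl
    · exact hs.1.1.le
  set s₀ := sSup A with hs₀
  have hs₀0 : 0 ≤ s₀ := le_csSup hAbdd (mem_insert _ _)
  have hs₀1 : s₀ ≤ s₁ := csSup_le hAne hAle
  have hs₁A : s₁ ∉ {s | s ∈ Ioc 0 s₁ ∧ b s ≤ H s} := fun h => (not_le.2 hlt) h.2
  have hs₀lt : s₀ < s₁ := by
    rcases eq_or_lt_of_le hs₀1 with h | h
    · -- `s₀ = s₁` would make `s₁` a limit of good points, hence good: contradiction below
      exfalso
      obtain ⟨u, -, hu, huA⟩ := exists_seq_tendsto_sSup hAne hAbdd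
      -- along `u n → s₁`: either `u n = 0` or `b (u n) ≤ H (u n) ≤ H s₁`
      have hbu : ∀ n, b (u n) ≤ max (b 0) (H s₁) := fun n => by
        rcases huA n with hu0 | hn
        · rw [hu0]; exact le_max_left _ _
        · exact (hn.2.trans (hH hn.1.2)).trans (le_max_right _ _)
      have hcont : Tendsto (fun n => b (u n)) atTop (𝓝 (b s₁)) := by
        have hc := (hb s₁ ⟨hs₁.1.le, hs₁.2.le⟩).tendsto
        rw [← h, hs₀] at hc ⊢
        refine (hc.comp (tendsto_nhdsWithin_iff.2 ⟨hu, Eventually.of_forall fun n =>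
          ⟨hA0 _ (huA n), (hAle _ (huA n)).trans hs₁.2.le⟩⟩))
      have hle : b s₁ ≤ max (b 0) (H s₁) := le_of_tendsto' hcont hbu
      rcases le_max_iff.1 hle with h1 | h1
      · exact (not_le.2 hlt) (h1.trans (h0 s₁ hs₁))
      · exact (not_le.2 hlt) h1
    · exact h
  -- every `t ∈ (s₀, s₁]` is bad, and `b s₀ ≤ H t`
  have hbad : ∀ t ∈ Ioc s₀ s₁, H t < b t := fun t ht => by
    by_contra h
    rw [not_lt] at h
    have htA : t ∈ A := mem_insert_of_mem _ ⟨⟨hs₀0.trans_lt ht.1, ht.2⟩, h⟩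
    exact (not_le.2 ht.1) (le_csSup hAbdd htA)
  have hgood : ∀ t ∈ Ioc s₀ s₁, b s₀ ≤ H t := fun t ht => by
    obtain ⟨u, -, hu, huA⟩ := exists_seq_tendsto_sSup hAne hAbdd
    have hbu : ∀ n, b (u n) ≤ H t := fun n => by
      rcases huA n with hu0 | hn
      · rw [hu0]; exact h0 t ⟨hs₀0.trans_lt ht.1, ht.2.trans_lt hs₁.2⟩
      · exact hn.2.trans (hH ((le_csSup hAbdd (huA n)).trans ht.1.le))
    have hcont : Tendsto (fun n => b (u n)) atTop (𝓝 (b s₀)) := by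
      have hc := (hb s₀ ⟨hs₀0, hs₀1.trans hs₁.2.le⟩).tendsto
      rw [hs₀] at hc ⊢
      exact hc.comp (tendsto_nhdsWithin_iff.2 ⟨hu, Eventually.of_forall fun n =>
        ⟨hA0 _ (huA n), (hAle _ (huA n)).trans hs₁.2.le⟩⟩)
    exact le_of_tendsto' hcont hbu
  -- the integral inequality on `(t, s₁)` for `t ∈ (s₀, s₁)`
  have hint : ∀ t ∈ Ioo s₀ s₁, 2 * (b s₁ - b t) ≤ H s₁ - H t := fun t ht => by
    have ht0 : 0 < t := hs₀0.trans_lt ht.1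
    have htS : Icc t s₁ ⊆ Ioo 0 S := fun s hs => ⟨ht0.trans_le hs.1, hs.2.trans_lt hs₁.2⟩
    -- `∫_{(t,s₁)} 2 b' ≤ ∫_{(t,s₁)} H' ≤ H s₁ - H t`
    have h1 : ∫⁻ s in Ioo t s₁, ENNReal.ofReal (2 * b' s) ≤
        ∫⁻ s in Ioo t s₁, ENNReal.ofReal (deriv H s) := by
      refine setLIntegral_mono_ae' measurableSet_Ioo ?_
      filter_upwards [hae] with s hs hsI
      have hs' : s ∈ Ioo 0 S := htS ⟨hsI.1.le, hsI.2.le⟩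
      exact ENNReal.ofReal_le_ofReal (hs hs' (hbad s ⟨ht.1.trans hsI.1, hsI.2.le⟩)).2
    have h2 := Monotone.lintegral_deriv_le hH t s₁
    -- evaluate the left-hand side by the fundamental theorem of calculus for `b`
    have hcont' : ContinuousOn (fun s => 2 * b' s) (Icc t s₁) :=
      (continuousOn_const.mul (hb'c.mono htS))
    have hintb : IntervalIntegrable (fun s => 2 * b' s) volume t s₁ :=
      (hcont'.intervalIntegrable_of_Icc ht.2.le)
    have hFTC : ∫ s in t..s₁, 2 * b' s = 2 * b s₁ - 2 * b t := by
      have := intervalIntegral.integral_eq_sub_of_hasDerivAt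
        (f := fun s => 2 * b s) (f' := fun s => 2 * b' s)
        (fun s hs => by
          rw [uIcc_of_le ht.2.le] at hs
          exact (hb' s (htS hs)).const_mul 2) hintb
      simpa using this
    have h3 : ∫⁻ s in Ioo t s₁, ENNReal.ofReal (2 * b' s) = ENNReal.ofReal (2 * (b s₁ - b t)) := by
      rw [mul_sub, ← hFTC, intervalIntegral.integral_of_le ht.2.le,
        ← ofReal_integral_eq_lintegral_ofReal]
      · rw [restrict_Ioo_eq_restrict_Ioc]
      · exact hintb.1.mono_set Ioo_subset_Ioc_self
      · refine (ae_restrict_mem measurableSet_Ioo).mono fun s hs => ?_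
        exact mul_nonneg zero_le_two (hb'0 s (htS ⟨hs.1.le, hs.2.le⟩))
    have h4 : ENNReal.ofReal (2 * (b s₁ - b t)) ≤ ENNReal.ofReal (H s₁ - H t) := by
      rw [← h3]; exact h1.trans h2
    exact (ENNReal.ofReal_le_ofReal_iff (sub_nonneg.2 (hH ht.2.le))).1 h4
  -- let `t ↓ s₀`: continuity of `b` at `s₀` within `[0, S]`
  set gap : ℝ := b s₁ - H s₁ with hgap
  have hgap0 : 0 < gap := sub_pos.2 hlt
  have hbs₀ : ContinuousWithinAt b (Icc 0 S) s₀ := hb s₀ ⟨hs₀0, hs₀1.trans hs₁.2.le⟩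
  have hev : ∀ᶠ t in 𝓝[Icc 0 S] s₀, dist (b t) (b s₀) < gap / 2 :=
    (Metric.tendsto_nhds.1 hbs₀.tendsto) _ (by positivity)
  -- points of `(s₀, s₁)` close to `s₀` lie in the filter
  have hfreq : ∃ t ∈ Ioo s₀ s₁, dist (b t) (b s₀) < gap / 2 := by
    rw [eventually_nhdsWithin_iff, Metric.eventually_nhds_iff] at hev
    obtain ⟨δ, hδ, hδ'⟩ := hev
    set t := min (s₀ + δ / 2) ((s₀ + s₁) / 2) with htdef
    have ht1 : s₀ < t := by rw [htdef]; exact lt_min (by linarith) (by linarith)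
    have ht2 : t < s₁ := lt_of_le_of_lt (min_le_right _ _) (by linarith)
    refine ⟨t, ⟨ht1, ht2⟩, hδ' ?_ ⟨hs₀0.trans ht1.le, (ht2.trans hs₁.2).le⟩⟩
    rw [Real.dist_eq, abs_of_pos (sub_pos.2 ht1)]
    linarith [min_le_left (s₀ + δ / 2) ((s₀ + s₁) / 2)]
  obtain ⟨t, ht, hdist⟩ := hfreq
  have h5 := hint t ht
  have h6 := hgood t ⟨ht.1, ht.2.le⟩
  have h7 : b s₀ ≤ b s₁ := hbm ⟨hs₀0, hs₀1.trans hs₁.2.le⟩ ⟨hs₁.1.le, hs₁.2.le⟩ hs₀1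
  rw [Real.dist_eq] at hdist
  have h8 := (abs_lt.1 hdist).2
  linarith

end Barrier

end Literature.Geometry.GeometricMeasureTheory
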